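import Summits.CriticalPhenomena.PercolationContinuityZ3.Theorems.PercFiniteBoxLROLinearScaleLROOfThetaShellTools
import HarnessLib

/-!
# `PercFiniteBoxLRO.LinearScaleLROOfTheta` (stmt-CriticalPhenomena-0855): Cerf's missing estimate
# follows from POSITIVE-PROBABILITY UNIQUENESS OF SHELL CROSSINGS at `p_c(ℤ³)`

Helper file (`--supports stmt-CriticalPhenomena-0855`) of line `registered` (lead c1).  Notation:
`P = P_{p_c}` bond percolation on `ℤ³`, `Λ_m = box 3 m`, `∂ⁱⁿΛ_m` its inner vertex boundary (the
sphere `‖x‖_∞ = m`), and for `m ≥ 1` the SHELL `A_m = Λ_{2m} ∖ Λ_{m-1} = {m ≤ ‖x‖_∞ ≤ 2m}`.  The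
*shell-uniqueness event* `U_m` says: any two sites of the inner sphere `∂ⁱⁿΛ_m` that are joined
INSIDE `A_m` to the outer sphere `∂ⁱⁿΛ_{2m}` are joined to each other inside `A_m` — i.e. the open
subgraph induced on the shell has AT MOST ONE cluster crossing it.

**Theorem** (`linearScaleLROOfTheta_of_shellUniqPos`).  If `P_{p_c}(U_m) ≥ δ > 0` for all
large `m` ("shell crossings are unique with positive probability, uniformly in the scale"), then
`LinearScaleLROOfTheta` (Cerf 2015, arXiv:1306.3105, p. 4: `θ(p) > 0 ⟹` finite-box long-range
order at linear scale).

Proof (`criticalFloor_of_shellUniqPos`; the rest is the landed reduction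
`linearScaleLROOfTheta_of_criticalFloor`).  Assume `θ := θ(p_c) > 0` and let `v = n e₀`.  By
Harris–FKG `P(0 ↔ ∞, v ↔ ∞) ≥ θ²`.  If `P(0 ↔ v inside Λ_{Kn}) < θ²/2`, then with probability
`> θ²/2` both `0` and `v` percolate but are NOT joined inside `Λ_{Kn}`.  On that event, for every
shell `A_{m_j}`, `m_j = 4^{j+1} n` (`j < J`, `2·4^J ≤ K`), the open paths from `0` and from `v` to
`∂Λ_{Kn}` contain crossings of `A_{m_j}` (`shell_segment`: last visit to the inner sphere before the
first visit to the outer sphere) which cannot be joined inside the shell (else `0 ↔ v` inside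
`Λ_{Kn}`), so `U_{m_j}` FAILS for all `j < J`.  The shells are pairwise disjoint, the events
`U_{m_j}` are determined by the edges inside their shells, hence independent, and
`θ²/2 < ∏_{j<J} (1 - P(U_{m_j})) ≤ (1-δ)^J`, absurd once `(1-δ)^J ≤ θ²/2`.  Small scales
`n < m₀` are covered by AKN pointwise local uniqueness (`tendsto_measure_badPair`) and Cerf's
Lemma 10.1, exactly as in the line's composition.

Why this matters for the crux.  After `linearScaleLROOfTheta_iff_criticalFloor` (p150787) the open
residue of `X_D` is a FATNESS statement about a hypothetical percolating `p_c` (a two-point floor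
at linear scale), for which the jump world offers no tool.  The hypothesis here is a THINNESS
statement at `p_c` that does not mention `θ(p_c)` at all, is believed in the orthodox
three-dimensional critical world (bounded number of spanning clusters, hyperscaling `d < 6`;
it provably fails for `d > 6` where spanning clusters proliferate, Aizenman 1997), strengthens the
route's own `CritBoxTwoArmsDecay` (two crossing clusters of `Λ(n^α) ∖ Λ(n)` for `α > 1`) to aspect
ratio `2` at the price of asking only probability `≥ δ` instead of `→ 1`, and is of the same family
as route `PercNonProliferation`'s crux.  It is OPEN; nothing here claims it.

## References

* R. Cerf, Ann. Probab. 43 (2015) 2458–2480, arXiv:1306.3105, p. 4 and §10 [Cerf2015].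
* M. Aizenman, Nucl. Phys. B 485 (1997) 551–582 (numbers of spanning clusters) [Aizenman1997].
* G. Grimmett, *Percolation*, 2nd ed. (1999), Thm (2.4) (Harris–FKG), §2.2 (events determined by
  disjoint edge sets are independent) [GrimmettPercolation1999].
-/

noncomputable section

namespace Summit.CriticalPhenomena.PercolationContinuityZ3.Theorems

namespace ShellUniq

open Literature.Probability.Percolation Literature.Probability.LatticeModels
open Literature.Probability.Percolation.DCT16
open MeasureTheory Filter Set
open scoped Topology ENNReal

/-! ## §4 The reduction -/

/-- **Positive-probability shell uniqueness ⟹ the critical one-site floor.**  Suppose that for some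
`δ > 0` and all `k ≥ k₀` the shell-uniqueness event of the shell `Λ_{2(k+1)} ∖ Λ_k` has
`P_{p_c}`-probability `≥ δ`.  Then `θ(p_c) > 0` implies: for some `ρ₀ > 0`, `K ≥ 1` and every
`n ≥ 1`, some `x ∈ ∂ⁱⁿΛ_n` (namely `n e₀`) has `P_{p_c}(0 ↔ x inside Λ_{Kn}) ≥ ρ₀`.
[cite: Cerf2015, p. 4 and §10] -/
theorem criticalFloor_of_shellUniqPos
    (hU : ∃ δ : ℝ, 0 < δ ∧ ∃ k₀ : ℕ, ∀ k : ℕ, k₀ ≤ k →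
      δ ≤ (bondPercolation (zdGraph 3) (criticalProbI 3)).real {ω : BondConfig (Site 3) |
        ∀ a ∈ innerBoundary (zdGraph 3) (box 3 (k + 1)), ∀ a' ∈ innerBoundary (zdGraph 3) (box 3 (k + 1)),
          (∃ b ∈ innerBoundary (zdGraph 3) (box 3 (2 * (k + 1))),
              ω ∈ openConnIn (↑(box 3 (2 * (k + 1)) \ box 3 k) : Set (Site 3)) a b) →
            (∃ b' ∈ innerBoundary (zdGraph 3) (box 3 (2 * (k + 1))),
              ω ∈ openConnIn (↑(box 3 (2 * (k + 1)) \ box 3 k) : Set (Site 3)) a' b') →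
              ω ∈ openConnIn (↑(box 3 (2 * (k + 1)) \ box 3 k) : Set (Site 3)) a a'})
    (hθ : 0 < theta (zdGraph 3) (0 : Site 3) (criticalProbI 3)) :
    ∃ ρ₀ : ℝ, 0 < ρ₀ ∧ ∃ K : ℕ, 1 ≤ K ∧ ∀ n : ℕ, 1 ≤ n →
      ∃ x ∈ innerBoundary (zdGraph 3) (box 3 n),
        ρ₀ ≤ (bondPercolation (zdGraph 3) (criticalProbI 3)).real
          (openConnIn (↑(box 3 (K * n)) : Set (Site 3)) (0 : Site 3) x) := by
  classical
  set p : unitInterval := criticalProbI 3 with hp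
  set μ := bondPercolation (zdGraph 3) p with hμ
  set θ₀ : ℝ := theta (zdGraph 3) (0 : Site 3) p with hθ₀
  -- the shell-uniqueness events, as a family
  set U : ℕ → Set (BondConfig (Site 3)) := fun k => {ω : BondConfig (Site 3) |
        ∀ a ∈ innerBoundary (zdGraph 3) (box 3 (k + 1)), ∀ a' ∈ innerBoundary (zdGraph 3) (box 3 (k + 1)),
          (∃ b ∈ innerBoundary (zdGraph 3) (box 3 (2 * (k + 1))),
              ω ∈ openConnIn (↑(box 3 (2 * (k + 1)) \ box 3 k) : Set (Site 3)) a b) →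
            (∃ b' ∈ innerBoundary (zdGraph 3) (box 3 (2 * (k + 1))),
              ω ∈ openConnIn (↑(box 3 (2 * (k + 1)) \ box 3 k) : Set (Site 3)) a' b') →
              ω ∈ openConnIn (↑(box 3 (2 * (k + 1)) \ box 3 k) : Set (Site 3)) a a'} with hUdef
  obtain ⟨δ, hδ, k₀, hk₀⟩ := hU
  have hUk : ∀ k, k₀ ≤ k → δ ≤ μ.real (U k) := fun k hk => hk₀ k hk
  have hθ2 : 0 < θ₀ ^ 2 := by positivity
  -- `δ ≤ 1`, so `0 ≤ 1 - δ < 1`, and a number `J` of shells with `(1-δ)^J < θ₀²/4`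
  have hδ1 : δ ≤ 1 := (hUk k₀ le_rfl).trans measureReal_le_one
  obtain ⟨J, hJ⟩ := exists_pow_lt_of_lt_one (show 0 < θ₀ ^ 2 / 4 by positivity)
    (show 1 - δ < 1 by linarith)
  -- small scales: AKN pointwise local uniqueness at the axis sites
  set ε : ℝ≥0∞ := ENNReal.ofReal (θ₀ ^ 2 / 4) with hε
  have hεpos : 0 < ε := by rw [hε, ENNReal.ofReal_pos]; positivity
  have hev : ∀ n ∈ Finset.range (k₀ + 1), ∀ᶠ j : ℕ in atTop,
      μ (badPair (n + j) (0 : Site 3) (Pi.single 0 (n : ℤ))) < ε := fun n _ =>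
    (tendsto_measure_badPair p (zero_mem_box 3 n) (LinearScaleLROReduction.single_mem_box n)).eventually
      (gt_mem_nhds hεpos)
  obtain ⟨j₀, hj₀⟩ := ((Finset.eventually_all (Finset.range (k₀ + 1))).2 hev).exists_forall_of_atTop
  -- the box factor
  set K : ℕ := max (2 * 4 ^ J) (j₀ + 1) with hK
  have hK1 : 1 ≤ K := le_trans (by omega) (le_max_right _ _)
  have hKJ : 2 * 4 ^ J ≤ K := le_max_left _ _
  have hKj : j₀ + 1 ≤ K := le_max_right _ _
  refine ⟨θ₀ ^ 2 / 2, by positivity, K, hK1, fun n hn =>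
    ⟨Pi.single 0 (n : ℤ), LinearScaleLROReduction.single_mem_innerBoundary n, ?_⟩⟩
  set v : Site 3 := Pi.single 0 (n : ℤ) with hv
  by_contra hlt
  rw [not_le] at hlt
  rcases lt_or_ge n (k₀ + 1) with hsmall | hlarge
  · -- small scale `n ≤ k₀`: local uniqueness at scale `K n ≥ n + j₀`, Cerf's Lemma 10.1
    obtain ⟨j, hj⟩ : ∃ j, K * n = n + j := Nat.exists_eq_add_of_le (Nat.le_mul_of_pos_left n (by omega))
    have h1 : (j₀ + 1) * n ≤ K * n := Nat.mul_le_mul_right n hKj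
    rw [add_mul, one_mul] at h1
    have h2 : j₀ ≤ j₀ * n := Nat.le_mul_of_pos_right j₀ (by omega)
    have hjge : j₀ ≤ j := by omega
    have hlt' := hj₀ j hjge n (Finset.mem_range.2 hsmall)
    have hreal : μ.real (badPair (n + j) (0 : Site 3) v) ≤ θ₀ ^ 2 / 4 := by
      rw [measureReal_def]
      have h := ENNReal.toReal_mono ENNReal.ofReal_ne_top hlt'.le
      rwa [ENNReal.toReal_ofReal (by positivity)] at h
    have hvbox : v ∈ box 3 (n + j) := box_mono 3 (by omega) (LinearScaleLROReduction.single_mem_box n)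
    have h10 := LinearScaleLROReduction.cerf_lemma_10_1 p (zero_mem_box 3 (n + j)) hvbox
    rw [hj] at hlt
    linarith
  · -- large scale: the split event and the `J` disjoint shells `Λ_{2·4^{j+1} n} ∖ Λ_{4^{j+1} n - 1}`
    have hn1 : 1 ≤ n := hn
    -- the split event has probability `> θ₀²/2`
    set E : Set (BondConfig (Site 3)) :=
      (percolatesAt (0 : Site 3) ∩ percolatesAt v) \ openConnIn (↑(box 3 (K * n)) : Set (Site 3)) 0 v
      with hE
    have hfkg : θ₀ ^ 2 ≤ μ.real (percolatesAt (0 : Site 3) ∩ percolatesAt v) := by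
      have h := harris_fkg_holds (zdGraph 3) p (isUpperSet_percolatesAt (0 : Site 3))
        (isUpperSet_percolatesAt v) (measurableSet_percolatesAt_holds (0 : Site 3))
        (measurableSet_percolatesAt_holds v)
      have hθv : μ.real (percolatesAt v) = θ₀ := theta_zdGraph_eq_theta_zero p v
      have hθ0 : μ.real (percolatesAt (0 : Site 3)) = θ₀ := rfl
      rw [hθv, hθ0] at h
      nlinarith [h]
    have hEge : θ₀ ^ 2 / 2 < μ.real E := by
      have hsub : percolatesAt (0 : Site 3) ∩ percolatesAt v ⊆
          E ∪ openConnIn (↑(box 3 (K * n)) : Set (Site 3)) 0 v := by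
        intro ω hω
        by_cases hc : ω ∈ openConnIn (↑(box 3 (K * n)) : Set (Site 3)) 0 v
        · exact Or.inr hc
        · exact Or.inl ⟨hω, hc⟩
      have h1 : μ.real (percolatesAt (0 : Site 3) ∩ percolatesAt v) ≤
          μ.real E + μ.real (openConnIn (↑(box 3 (K * n)) : Set (Site 3)) 0 v) :=
        (measureReal_mono hsub).trans (measureReal_union_le _ _)
      linarith
    -- the shells: index `k j = 4^{j+1} n - 1`
    set m : ℕ → ℕ := fun j => 4 ^ (j + 1) * n with hm
    have hm1 : ∀ j, n + 1 ≤ m j := fun j => by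
      have : 4 ≤ 4 ^ (j + 1) := by
        calc (4 : ℕ) = 4 ^ 1 := by norm_num
          _ ≤ 4 ^ (j + 1) := Nat.pow_le_pow_right (by norm_num) (by omega)
      have : 4 * n ≤ 4 ^ (j + 1) * n := Nat.mul_le_mul_right n this
      show n + 1 ≤ 4 ^ (j + 1) * n
      omega
    set k : ℕ → ℕ := fun j => m j - 1 with hk
    have hk1 : ∀ j, k j + 1 = m j := fun j => Nat.sub_add_cancel (by have := hm1 j; omega)
    have hnk : ∀ j, n ≤ k j := fun j => by have := hm1 j; have := hk1 j; omega
    -- shells with `j < J` fit inside `Λ_{Kn}`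
    have hfit : ∀ j, j < J → 2 * (k j + 1) ≤ K * n := fun j hj => by
      rw [hk1 j]
      show 2 * (4 ^ (j + 1) * n) ≤ K * n
      have h4 : 4 ^ (j + 1) ≤ 4 ^ J := Nat.pow_le_pow_right (by norm_num) hj
      calc 2 * (4 ^ (j + 1) * n) = (2 * 4 ^ (j + 1)) * n := by ring
        _ ≤ (2 * 4 ^ J) * n := Nat.mul_le_mul_right n (by omega)
        _ ≤ K * n := Nat.mul_le_mul_right n hKJ
    -- disjointness of the shells' edge sets
    set F : ℕ → Finset (Sym2 (Site 3)) := fun j => (box 3 (2 * (k j + 1)) \ box 3 (k j)).sym2 with hF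
    have hshell_disj : ∀ i j, i < j → Disjoint (box 3 (2 * (k i + 1)) \ box 3 (k i))
        (box 3 (2 * (k j + 1)) \ box 3 (k j)) := by
      intro i j hij
      rw [Finset.disjoint_left]
      intro z hzi hzj
      rw [Finset.mem_sdiff] at hzi hzj
      apply hzj.2
      refine box_mono 3 ?_ hzi.1
      -- `2 m_i ≤ m_j - 1`
      rw [hk1 i]
      have h4 : 4 ^ (i + 1 + 1) ≤ 4 ^ (j + 1) := Nat.pow_le_pow_right (by norm_num) (by omega)
      have h4n : 4 ^ (i + 1 + 1) * n ≤ 4 ^ (j + 1) * n := Nat.mul_le_mul_right n h4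
      have hkj : k j + 1 = 4 ^ (j + 1) * n := hk1 j
      have : 2 * (4 ^ (i + 1) * n) + 1 ≤ 4 ^ (i + 1 + 1) * n := by
        rw [pow_succ 4 (i + 1)]
        have : 1 ≤ 4 ^ (i + 1) * n := Nat.one_le_iff_ne_zero.2 (by positivity)
        nlinarith
      show 2 * (4 ^ (i + 1) * n) ≤ k j
      omega
    have hFdisj : ∀ i j, i < j → j < J → Disjoint (F i) (F j) := by
      intro i j hij _
      rw [Finset.disjoint_left]
      intro e hei hej
      induction e using Sym2.ind with
      | h x y =>
        rw [hF, Finset.mk_mem_sym2_iff] at hei hej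
        exact Finset.disjoint_left.1 (hshell_disj i j hij) hei.1 hej.1
    -- on the split event every shell-uniqueness event `U (k j)`, `j < J`, fails
    have hEsub : μ.real E ≤ μ.real (⋂ j ∈ Finset.range J, (U (k j))ᶜ) := by
      refine real_mono_of_forall_subset_edgeSet (zdGraph 3) p fun ω hω hωE => ?_
      simp only [Set.mem_iInter, Finset.mem_range]
      intro j hj
      obtain ⟨⟨h0, hvp⟩, hnc⟩ := hωE
      obtain ⟨a, ha, a', ha', hab, ha'b', hnaa'⟩ :=
        shell_split hω (box_mono 3 (hnk j) (LinearScaleLROReduction.single_mem_box n)) (hfit j hj) h0 hvp hnc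
      simp only [hUdef, Set.mem_compl_iff, Set.mem_setOf_eq, not_forall]
      exact ⟨a, ha, a', ha', hab, ha'b', hnaa'⟩
    -- independence: the failures have probability `≤ (1-δ)^J`
    have hpow : μ.real (⋂ j ∈ Finset.range J, (U (k j))ᶜ) ≤ (1 - δ) ^ J := by
      refine real_biInter_le_pow p (A := fun j => (U (k j))ᶜ) (F := F) (fun j => ?_) hFdisj
        (by linarith) fun j hj => ?_
      · -- locality of the complement
        have h := determinedBy_shellUniq (k j)
        rw [determinedBy_iff] at h ⊢
        intro ω ω' hωω'
        rw [Set.mem_compl_iff, Set.mem_compl_iff, h ω ω' hωω']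
      · have hmeas : MeasurableSet (U (k j)) := (determinedBy_shellUniq (k j)).measurableSet_of_finset
        rw [measureReal_compl hmeas, probReal_univ]
        have hkj : k₀ ≤ k j := by have := hnk j; omega
        linarith [hUk (k j) hkj]
    -- contradiction
    linarith

end ShellUniq

open Literature.Probability.Percolation Literature.Probability.LatticeModels MeasureTheory

/-- **Positive-probability uniqueness of shell crossings at `p_c(ℤ³)` implies Cerf's missing
estimate `X_D`.**  Hypothesis (OPEN; a thinness statement about critical percolation in `d = 3`,
believed by hyperscaling, false for `d > 6`): there are `δ > 0` and `k₀` such that for every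
`k ≥ k₀`, with `P_{p_c}`-probability at least `δ`, any two sites of the sphere `∂ⁱⁿΛ_{k+1}` that are
joined inside the shell `Λ_{2(k+1)} ∖ Λ_k` to the sphere `∂ⁱⁿΛ_{2(k+1)}` are joined to each other
inside that shell (the open subgraph induced on the shell has at most one crossing cluster).
Conclusion: `LinearScaleLROOfTheta` — for every `p` with `θ(p) > 0` there are `ρ > 0` and `K` with
`P_p(x ↔ y inside Λ_{Kn}) ≥ ρ` for all `n ≥ 1`, `x, y ∈ Λ_n` (Cerf 2015, p. 4).  Proof:
`ShellUniq.criticalFloor_of_shellUniqPos` (Harris–FKG for `{0 ↔ ∞} ∩ {n e₀ ↔ ∞}`, shell segments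
of the two arms, independence of `J` disjoint shells) and the landed reduction
`linearScaleLROOfTheta_of_criticalFloor` (below `p_c` void, above `p_c` slab technology, at `p_c`
the FKG–symmetry chaining `stub_fkgChaining`). [cite: Cerf2015, p. 4 and §10] -/
theorem linearScaleLROOfTheta_of_shellUniqPos :
    (∃ δ : ℝ, 0 < δ ∧ ∃ k₀ : ℕ, ∀ k : ℕ, k₀ ≤ k →
      δ ≤ (bondPercolation (zdGraph 3) (criticalProbI 3)).real {ω : BondConfig (Site 3) |
        ∀ a ∈ innerBoundary (zdGraph 3) (box 3 (k + 1)), ∀ a' ∈ innerBoundary (zdGraph 3) (box 3 (k + 1)),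
          (∃ b ∈ innerBoundary (zdGraph 3) (box 3 (2 * (k + 1))),
              ω ∈ openConnIn (↑(box 3 (2 * (k + 1)) \ box 3 k) : Set (Site 3)) a b) →
            (∃ b' ∈ innerBoundary (zdGraph 3) (box 3 (2 * (k + 1))),
              ω ∈ openConnIn (↑(box 3 (2 * (k + 1)) \ box 3 k) : Set (Site 3)) a' b') →
              ω ∈ openConnIn (↑(box 3 (2 * (k + 1)) \ box 3 k) : Set (Site 3)) a a'}) →
    Summit.CriticalPhenomena.PercolationContinuityZ3.Theses.PercFiniteBoxLRO.LinearScaleLROOfTheta :=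
  fun hU => linearScaleLROOfTheta_of_criticalFloor (ShellUniq.criticalFloor_of_shellUniqPos hU)


end Summit.CriticalPhenomena.PercolationContinuityZ3.Theorems

end
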